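import Summits.QuantumFields.YangMills.Theorems.Instrument.TorusPlaquetteGeometry
import Summits.QuantumFields.YangMills.Theorems.Instrument.PlaquetteLinkGeometry
import Literature.MathematicalPhysics.QuantumFieldTheory.StrongCouplingTorusSystem
import HarnessLib

/-!
# Instrument cell `ym-instrument`, crew (b): the covering map `ℤ⁴ → (ℤ/L)⁴` on plaquettes and links — foundations for RADIUS-DERIVATION v0.6.2 (7.0) LEMMA W (the torus census
# identity): images of link sets, unique lifting of a plaquette through a lifted link, local injectivity, and preservation of the comb-gauge parity for EVEN `L`

QUESTIONS.md: Q-B2 (S2-SPEC v0.5.1 §0 reading (β-torus); RADIUS-DERIVATION (7.0) «(side ≥ 4: π is injective on the 4 links of a plaquette and on the 6 plaquettes through a link;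
axis∕free parity is 2-periodic, so π respects it)»); cell `run/shared/lean/pub/ym-instrument/`, HUMAN RULING D-0084 (2), director-ym R138.  HONEST FRAMING (page 1, binding).
WHAT IS CERTIFIED HERE: PURE COMBINATORICS — the plaquette covering map `πP L : ZdPlaquette 4 → TPlaquette L` (base point reduced mod `L`, the tree's `Torus.proj`; links by the
tree's `QuantumLattice.torusEdge`): `tEdges (πP L p) = (plaquetteEdges p).image (torusEdge L)`; LIFTING: a torus plaquette containing the image of a `ℤ⁴` link `e` is the image of
a `ℤ⁴` plaquette containing `e` (`exists_lift_plaquette`), UNIQUELY for `L ≥ 3` (`lift_unique`: two plaquettes through a common link with the same image coincide); PARITY: for even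
`L`, `torusEdge L e` is an axis (resp. free) torus link iff `e` is an axis (resp. free) link of `ℤ⁴` (`isAxisLinkT_torusEdge_iff`).  These are steps of Lemma W's (W2)∕(W3); the
census identity itself is NOT in this file.  NOT a statement about any gauge theory; NOT summit-bearing.  Grade (T).
-/

noncomputable section

open Finset
open Literature.MathematicalPhysics.QuantumLattice (ZdEdge ZdPlaquette plaquetteEdges torusEdge)
open Literature.MathematicalPhysics.QuantumFieldTheory (mk_mem_plaquetteEdges_iff torusProj_site_add_single torusProj_site_add torusProj_site_single)
open Literature.Probability.LatticeModels (Site Torus.proj Torus.proj_apply)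
open Summit.QuantumFields.YangMills.Theorems.Instrument.FreeLinkPolymerDefs (IsAxisLink IsFreeLink)
open Summit.QuantumFields.YangMills.Theorems.Instrument.TorusPolymerKraft (TSite TEdge TPlaquette tEdges IsAxisLinkT IsFreeLinkT)
open Summit.QuantumFields.YangMills.Theorems.Instrument.TorusPlaquetteGeometry (mk_mem_tEdges_iff eq_of_mem_tEdges_of_ne single_index_injective_T add_single_ne_self_T)

namespace Summit.QuantumFields.YangMills.Theorems.Instrument.TorusCovering

variable {L : ℕ}

/-! ## §1 The covering map on sites, links, plaquettes -/

/-- The site projection `ℤ⁴ → (ℤ/L)⁴` (the tree's `Torus.proj`, typed at the torus site type of `ConstructiveQFTWave0`). [folklore] -/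
abbrev πS (L : ℕ) (x : Site 4) : TSite L := Torus.proj L x

/-- The plaquette projection: reduce the base point, keep the plane. [folklore] -/
def πP (L : ℕ) (p : ZdPlaquette 4) : TPlaquette L := (πS L p.1, p.2)

/-- The link projection is the tree's `torusEdge`: `torusEdge L (x, i) = (πS L x, i)`. [folklore] -/
theorem torusEdge_eq (L : ℕ) (e : ZdEdge 4) : torusEdge L e = ((πS L e.1, e.2) : TEdge L) := rfl

/-- `πS` intertwines the unit steps: `πS (x + e_i) = πS x + e_i`. [folklore] -/
theorem πS_add_single (L : ℕ) (x : Site 4) (i : Fin 4) : πS L (x + Pi.single i 1) = πS L x + Pi.single i 1 := by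
  unfold πS
  rw [torusProj_site_add, torusProj_site_single]

/-- **The links of a projected plaquette are the projected links.** [folklore] -/
theorem tEdges_πP (L : ℕ) (p : ZdPlaquette 4) : tEdges (πP L p) = (plaquetteEdges p).image (torusEdge L) := by
  obtain ⟨x, ⟨⟨i, j⟩, hij⟩⟩ := p
  simp only [tEdges, πP, plaquetteEdges, image_insert, image_singleton, torusEdge_eq, πS_add_single]

/-- A link of `p` projects to a link of `πP p`. [folklore] -/
theorem torusEdge_mem_tEdges {L : ℕ} {p : ZdPlaquette 4} {e : ZdEdge 4} (he : e ∈ plaquetteEdges p) : torusEdge L e ∈ tEdges (πP L p) := by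
  rw [tEdges_πP]; exact mem_image_of_mem _ he

/-- **Lifting of plaquettes through a lifted link**: if the projection of the `ℤ⁴` link `e` is a link of the torus plaquette `q̄`, then `q̄ = πP p` for a `ℤ⁴` plaquette `p ∋ e`.
[folklore] -/
theorem exists_lift_plaquette {L : ℕ} {e : ZdEdge 4} {q : TPlaquette L} (h : torusEdge L e ∈ tEdges q) : ∃ p : ZdPlaquette 4, πP L p = q ∧ e ∈ plaquetteEdges p := by
  obtain ⟨y, ⟨⟨a, b⟩, hab⟩⟩ := q
  obtain ⟨x, i⟩ := e
  rw [torusEdge_eq, mk_mem_tEdges_iff] at h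
  dsimp only at h
  rcases h with ⟨hai, h | h⟩ | ⟨hbi, h | h⟩
  · -- `a = i`, `πS x = y`: lift with base `x`
    subst hai
    refine ⟨(x, ⟨(a, b), hab⟩), ?_, by simp [plaquetteEdges]⟩
    simp only [πP, h]
  · -- `a = i`, `πS x = y + e_b`: lift with base `x − e_b`
    subst hai
    refine ⟨(x - Pi.single b 1, ⟨(a, b), hab⟩), ?_, ?_⟩
    · simp only [πP, Prod.mk.injEq]
      have : πS L (x - Pi.single b 1) + Pi.single b 1 = y + Pi.single b 1 := by rw [← πS_add_single, sub_add_cancel, h]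
      exact ⟨add_right_cancel this, trivial⟩
    · rw [mk_mem_plaquetteEdges_iff]; dsimp only; exact Or.inl ⟨rfl, Or.inr (by rw [sub_add_cancel])⟩
  · -- `b = i`, `πS x = y + e_a`: lift with base `x − e_a`
    subst hbi
    refine ⟨(x - Pi.single a 1, ⟨(a, b), hab⟩), ?_, ?_⟩
    · simp only [πP, Prod.mk.injEq]
      have : πS L (x - Pi.single a 1) + Pi.single a 1 = y + Pi.single a 1 := by rw [← πS_add_single, sub_add_cancel, h]
      exact ⟨add_right_cancel this, trivial⟩
    · rw [mk_mem_plaquetteEdges_iff]; dsimp only; exact Or.inr ⟨rfl, Or.inl (by rw [sub_add_cancel])⟩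
  · -- `b = i`, `πS x = y`
    subst hbi
    refine ⟨(x, ⟨(a, b), hab⟩), ?_, ?_⟩
    · simp only [πP, h]
    · rw [mk_mem_plaquetteEdges_iff]; dsimp only; exact Or.inr ⟨rfl, Or.inr rfl⟩

/-- **Local injectivity (uniqueness of lifts)**, `L ≥ 3`: two `ℤ⁴` plaquettes through a common link with the same projection coincide. [folklore] -/
theorem lift_unique (hL : 3 ≤ L) {e : ZdEdge 4} {p p' : ZdPlaquette 4} (he : e ∈ plaquetteEdges p) (he' : e ∈ plaquetteEdges p') (hπ : πP L p = πP L p') : p = p' := by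
  obtain ⟨x, ⟨⟨i, j⟩, hij⟩⟩ := p
  obtain ⟨x', ⟨⟨i', j'⟩, hij'⟩⟩ := p'
  simp only [πP, Prod.mk.injEq] at hπ
  obtain ⟨hπ1, hπ2⟩ := hπ
  have hplane : (⟨(i, j), hij⟩ : {q : Fin 4 × Fin 4 // q.1 < q.2}) = ⟨(i', j'), hij'⟩ := hπ2
  simp only [Subtype.mk.injEq, Prod.mk.injEq] at hplane
  obtain ⟨rfl, rfl⟩ := hplane
  -- same plane; the base points differ by a vector in `{0, ±e_i, ±e_j, ±e_i ± e_j}` and have equal projections ⇒ equal (each coordinate difference has |·| ≤ 1 < L... ≤ 2 < L)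
  obtain ⟨z, m⟩ := e
  rw [mk_mem_plaquetteEdges_iff] at he he'
  dsimp only at he he'
  suffices hx : x = x' by subst hx; rfl
  have key : ∀ (u v : Site 4) (c : Fin 4), πS L u = πS L v → (u = v ∨ u = v + Pi.single c 1 ∨ v = u + Pi.single c 1) → u = v := by
    intro u v c hπuv huv
    rcases huv with h | h | h
    · exact h
    · exfalso
      have : πS L v + Pi.single c 1 = πS L v := by rw [← πS_add_single, ← h, hπuv]
      exact add_single_ne_self_T (by omega) _ c this
    · exfalso
      have : πS L u + Pi.single c 1 = πS L u := by rw [← πS_add_single, ← h, hπuv]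
      exact add_single_ne_self_T (by omega) _ c this
  have key2 : ∀ (u v : Site 4) (c c' : Fin 4), c ≠ c' → πS L u = πS L v → u + Pi.single c 1 = v + Pi.single c' 1 → False := by
    intro u v c c' hcc' hπuv h
    have h1 : πS L u + Pi.single c 1 = πS L u + Pi.single c' 1 := by
      rw [← πS_add_single, h, πS_add_single, hπuv]
    exact hcc' (single_index_injective_T (by omega) (add_left_cancel h1))
  -- case analysis on how `e` sits in `p` and in `p'`
  rcases he with ⟨hmi, hz⟩ | ⟨hmj, hz⟩ <;> rcases he' with ⟨hmi', hz'⟩ | ⟨hmj', hz'⟩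
  · -- both direction `i`: `z ∈ {x, x + e_j}` and `z ∈ {x', x' + e_j}`
    rcases hz with rfl | rfl <;> rcases hz' with h | h
    · exact key _ _ j hπ1 (Or.inl h)
    · exact key _ _ j hπ1 (Or.inr (Or.inl h))
    · exact key _ _ j hπ1 (Or.inr (Or.inr h.symm))
    · exact key _ _ j hπ1 (Or.inl (add_right_cancel h))
  · exact absurd (hmi.trans hmj'.symm) (ne_of_lt (show i < j from hij))
  · exact absurd (hmi'.trans hmj.symm) (ne_of_lt (show i < j from hij))
  · -- both direction `j`: `z ∈ {x + e_i, x}` and `z ∈ {x' + e_i, x'}`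
    rcases hz with rfl | rfl <;> rcases hz' with h | h
    · exact key _ _ i hπ1 (Or.inl (add_right_cancel h))
    · exact key _ _ i hπ1 (Or.inr (Or.inr h.symm))
    · exact key _ _ i hπ1 (Or.inr (Or.inl h))
    · exact key _ _ i hπ1 (Or.inl h)

/-! ## §2 Parity: the covering map preserves axis ∕ free links for even `L` -/

/-- For even `L`, the residue `((z : ℤ) : ZMod L).val` has the parity of `z`. [folklore] -/
theorem even_val_intCast_iff [NeZero L] (hLe : Even L) (z : ℤ) : Even ((z : ZMod L)).val ↔ Even z := by
  have hv : (((z : ZMod L)).val : ℤ) = z % L := ZMod.val_intCast z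
  have h1 : Even ((z : ZMod L)).val ↔ Even (((z : ZMod L)).val : ℤ) := (Int.even_coe_nat _).symm
  have h2 : (2 : ℤ) ∣ (L : ℤ) := by exact_mod_cast hLe.two_dvd
  rw [h1, hv, Int.even_iff, Int.even_iff, Int.emod_emod_of_dvd z h2]

/-- ★ For even `L`, a `ℤ⁴` link is an axis link iff its projection is an axis link of the torus. [folklore] -/
theorem isAxisLinkT_torusEdge_iff [NeZero L] (hLe : Even L) (e : ZdEdge 4) : IsAxisLinkT (torusEdge L e) ↔ IsAxisLink e := by
  rw [torusEdge_eq]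
  simp only [IsAxisLinkT, IsAxisLink]
  refine forall_congr' fun ν => imp_congr_right fun _ => ?_
  rw [show (πS L e.1) ν = ((e.1 ν : ℤ) : ZMod L) from Torus.proj_apply L e.1 ν]
  exact even_val_intCast_iff hLe (e.1 ν)

/-- ★ For even `L`, a `ℤ⁴` link is free iff its projection is a free torus link. [folklore] -/
theorem isFreeLinkT_torusEdge_iff [NeZero L] (hLe : Even L) (e : ZdEdge 4) : IsFreeLinkT (torusEdge L e) ↔ IsFreeLink e :=
  not_congr (isAxisLinkT_torusEdge_iff hLe e)

end Summit.QuantumFields.YangMills.Theorems.Instrument.TorusCovering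

end
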